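import Summits.NavierStokesRegularity.FluidComputer.AngularGalerkinLadder
import Summits.NavierStokesRegularity.NavierStokesRegularity.Theorems.LocalCompactness.Negative.DefectBoundDegenerate
import Literature.Analysis.FluidPDE.CurlFreeLiouville
import Literature.Analysis.FluidPDE.ClassicalSolutionCalculus
import HarnessLib

/-!
# Route `AngularGalerkinLadder` · K2 `NoOverheating` — Negative lane, KJ-28:
# the PHYSICAL GAUGE of birth skeleton v4 pins the rest state (its defect is zero)

Cell `ns-blowup`, refuter lineage `ns-blowup-refuter` (g15), K-row KJ-28; `--supports
stmt-NavierStokesRegularity-19960`.  LABEL: KERNEL, Negative lane — small-model / gauge facts about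
the vocabulary `FluidComputer/AngularGalerkinLadder.lean`; NO route or crux file is imported and
nothing here asserts a Theses declaration.  WHAT THIS IS NOT: not Navier–Stokes evidence and not a
statement about the item `NoOverheating` (an `∃` over window profiles, untouched) — it is the
kernel certificate behind the junk record of the K2 PLAN: the v3 stub `stub_defect_decay` was
refuted by the REST STATE in the constant-force gauge (`u ≡ 0`, `p = ⟪e, ·⟫`, `d ≡ e`;
`Theorems/NoOverheating/Negative/DefectGauge.lean` (p488158) and `…/DefectGaugeDivFree.lean`
(p488725): the constant force is even divergence free, so the envelope clause below is
load-bearing), and the planner's repair v4 (`Cruxes/NoOverheating/Lines/birth.lean`, sha16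
a828c3ca356d4a09) quantifies its defect stub only over profiles in the PHYSICAL GAUGE
`InPhysicalGauge M d := (∀ t < 0, IsDivFree (d t)) ∧ HasDefectBound M d`.
This file proves that the repair removes the WHOLE rest-state witness class, not just the constant
force: for `u ≡ 0` the momentum equation reads `d = ∇p` on every slice (§1), so a physical-gauge
defect slice is a smooth curl-free, divergence-free field bounded by the envelope, hence CONSTANT
(tree `eq_of_curl_eq_zero_of_isDivFree_of_bounded`, the harmonic Liouville step of KNSS 2009
Lemma 3.1), and the envelope `M/(‖x‖+√−t)³ → 0` along a ray forces the constant to be `0` (§3).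
Consequently v4's stub-2 conclusion `HasDefectBound η d` HOLDS on every rest-state profile in the
physical gauge for every `η ≥ 0` (§4): the v3 witness class misses the repaired letter (class
`stub-misstated`, C′ = v4, witness misses C′ — now a kernel fact), and any inhabitant of v4 stub 2's
hypotheses with a non-zero defect has `u ≢ 0` on the open past, i.e. is a genuine Type-I rotated-DSS
ancient `NS_L` profile.  §5 records the gauge FIXING for a general velocity: two physical-gauge
representatives `(p, d)`, `(p', d')` of the same classical solution `u` have the same defect on the
open past (they differ by a decaying harmonic gradient).
[cite: KochNadirashviliSereginSverak2009, Lemma 3.1 (bounded curl-free div-free fields are constant)]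
-/

noncomputable section

namespace Summit.NavierStokesRegularity.NoOverheatingPhysicalGaugeRestState

open Set Filter Topology Function MeasureTheory
open scoped RealInnerProductSpace ContDiff Laplacian InnerProductSpace
open Literature.Analysis.FluidPDE
open Summit.NavierStokesRegularity.FluidComputer
open Summit.NavierStokesRegularity.FluidComputer.AngularLadder
open Summit.NavierStokesRegularity.LocalCompactnessDefectBoundDegenerate

variable {S : Set ℝ} {ν M : ℝ}
  {u : ℝ → EuclideanSpace ℝ (Fin 3) → EuclideanSpace ℝ (Fin 3)}
  {p p' : ℝ → EuclideanSpace ℝ (Fin 3) → ℝ}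
  {d d' : ℝ → EuclideanSpace ℝ (Fin 3) → EuclideanSpace ℝ (Fin 3)}

/-! ## §1 At rest the force is the pressure gradient -/

/-- For the rest state `u ≡ 0` the momentum equation `∂ₜu + (u·∇)u = νΔu − ∇p + d` reads
`0 = −∇p + d`: on every slice of the time set the force IS the pressure gradient. [folklore] -/
theorem defect_eq_gradient_of_rest (h : IsClassicalNSSolutionOn S ν d 0 p) {t : ℝ} (ht : t ∈ S)
    (x : EuclideanSpace ℝ (Fin 3)) : d t x = gradient (p t) x := by
  have hm := h.momentum t ht x
  have h1 : timeDerivWithin S (0 : ℝ → EuclideanSpace ℝ (Fin 3) → EuclideanSpace ℝ (Fin 3)) t x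
      = 0 := by
    simp [timeDerivWithin]
  have h2 : convect ((0 : ℝ → EuclideanSpace ℝ (Fin 3) → EuclideanSpace ℝ (Fin 3)) t)
      ((0 : ℝ → EuclideanSpace ℝ (Fin 3) → EuclideanSpace ℝ (Fin 3)) t) x = 0 := by
    simp [convect]
  have h3 : Δ ((0 : ℝ → EuclideanSpace ℝ (Fin 3) → EuclideanSpace ℝ (Fin 3)) t) x = 0 := by
    show Δ (fun _ : EuclideanSpace ℝ (Fin 3) => (0 : EuclideanSpace ℝ (Fin 3))) x = 0
    rw [InnerProductSpace.laplacian_const]; rfl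
  rw [h1, h2, h3, add_zero, smul_zero, zero_sub] at hm
  -- `hm : 0 = -∇p + d`
  have h4 : d t x - gradient (p t) x = 0 := by rw [sub_eq_neg_add]; exact hm.symm
  exact sub_eq_zero.mp h4

/-- Slice form of §1: `d t = ∇(p t)`. [folklore] -/
theorem defect_slice_eq_gradient_of_rest (h : IsClassicalNSSolutionOn S ν d 0 p) {t : ℝ}
    (ht : t ∈ S) : d t = gradient (p t) :=
  funext (defect_eq_gradient_of_rest h ht)

/-- Hence every defect slice of a rest-state classical solution is smooth. [folklore] -/
theorem contDiff_defect_of_rest (h : IsClassicalNSSolutionOn S ν d 0 p) {t : ℝ} (ht : t ∈ S) :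
    ContDiff ℝ ∞ (d t) := by
  rw [defect_slice_eq_gradient_of_rest h ht]
  have hp : ContDiff ℝ ∞ (p t) := h.contDiff_pressure ht
  have e : gradient (p t) = fun x =>
      (InnerProductSpace.toDual ℝ (EuclideanSpace ℝ (Fin 3))).symm (fderiv ℝ (p t) x) := rfl
  rw [e]
  exact (InnerProductSpace.toDual ℝ (EuclideanSpace ℝ (Fin 3))).symm.contDiff.comp
    (contDiff_infty_iff_fderiv.1 hp).2

/-- … and curl free (`curl ∇p = 0`, tree `curl_gradient_eq_zero_holds`). [folklore] -/
theorem curl_defect_of_rest (h : IsClassicalNSSolutionOn S ν d 0 p) {t : ℝ} (ht : t ∈ S)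
    (x : EuclideanSpace ℝ (Fin 3)) : curl (d t) x = 0 := by
  rw [defect_slice_eq_gradient_of_rest h ht]
  exact curl_gradient_eq_zero_holds (p t) ((h.contDiff_pressure ht).of_le (by norm_cast)) x

/-! ## §2 The scale-invariant envelope: a uniform bound on each past slice, decay along rays -/

/-- The envelope bounds every past slice uniformly: `‖d(t,x)‖ ≤ M/√(−t)³`. [folklore] -/
theorem HasDefectBound.norm_le_unif (hM : HasDefectBound M d) {t : ℝ} (ht : t < 0)
    (x : EuclideanSpace ℝ (Fin 3)) : ‖d t x‖ ≤ M / Real.sqrt (-t) ^ 3 := by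
  have hM0 : 0 ≤ M := HasDefectBound.nonneg hM
  have hst : 0 < Real.sqrt (-t) := Real.sqrt_pos.2 (by linarith)
  calc ‖d t x‖ ≤ M / (‖x‖ + Real.sqrt (-t)) ^ 3 := hM t ht x
    _ ≤ M / Real.sqrt (-t) ^ 3 := by
        apply div_le_div_of_nonneg_left hM0 (by positivity)
        exact pow_le_pow_left₀ hst.le (by linarith [norm_nonneg x]) 3

/-- The envelope `M/(r + s)³` tends to `0` along a ray (`r → ∞`). [folklore] -/
theorem tendsto_envelope_ray (M s : ℝ) :
    Tendsto (fun r : ℝ => M / (r + s) ^ 3) atTop (𝓝 0) := by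
  have h2 : Tendsto (fun r : ℝ => (r + s) ^ 3) atTop atTop :=
    (tendsto_pow_atTop three_ne_zero).comp (tendsto_atTop_add_const_right _ _ tendsto_id)
  exact Tendsto.div_atTop tendsto_const_nhds h2

/-- `‖r • e₀‖ = r` for `r ≥ 0`. [folklore] -/
theorem norm_smul_axis_zero {r : ℝ} (hr : 0 ≤ r) :
    ‖r • (axis 0 : EuclideanSpace ℝ (Fin 3))‖ = r := by
  have h1 : ‖(axis 0 : EuclideanSpace ℝ (Fin 3))‖ = 1 := by
    rw [axis, PiLp.norm_single, norm_one]
  rw [norm_smul, Real.norm_of_nonneg hr, h1, mul_one]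

/-- A field that is CONSTANT and inside an envelope `M/(‖x‖ + s)³` is zero. [folklore] -/
theorem eq_zero_of_const_of_envelope {V : EuclideanSpace ℝ (Fin 3) → EuclideanSpace ℝ (Fin 3)}
    (hconst : ∀ x y, V x = V y) {s : ℝ} (hV : ∀ x, ‖V x‖ ≤ M / (‖x‖ + s) ^ 3) : V = 0 := by
  have hev : ∀ᶠ r : ℝ in atTop, ‖V 0‖ ≤ M / (r + s) ^ 3 := by
    filter_upwards [eventually_ge_atTop (0 : ℝ)] with r hr
    have hx := hV (r • axis 0)
    rw [norm_smul_axis_zero hr, hconst (r • axis 0) 0] at hx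
    exact hx
  have hle : ‖V 0‖ ≤ 0 := ge_of_tendsto (tendsto_envelope_ray M s) hev
  have h0 : V 0 = 0 := norm_le_zero_iff.mp hle
  funext x
  rw [hconst x 0, h0]
  rfl

/-! ## §3 The rest state in the physical gauge has NO defect -/

/-- On a slice where the defect of a rest-state classical solution is divergence free and bounded,
it is CONSTANT: it is the smooth curl-free, divergence-free, bounded field `∇p(t,·)`, constant by
the harmonic Liouville step of KNSS 2009 Lemma 3.1 (tree
`eq_of_curl_eq_zero_of_isDivFree_of_bounded`). [cite: KochNadirashviliSereginSverak2009, Lemma 3.1] -/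
theorem defect_slice_const_of_rest (h : IsClassicalNSSolutionOn S ν d 0 p) {t : ℝ} (ht : t ∈ S)
    (hdiv : VectorCalculus.IsDivFree (d t)) {B : ℝ} (hB : ∀ x, ‖d t x‖ ≤ B)
    (x y : EuclideanSpace ℝ (Fin 3)) : d t x = d t y :=
  eq_of_curl_eq_zero_of_isDivFree_of_bounded ((contDiff_defect_of_rest h ht).of_le (by norm_cast))
    (curl_defect_of_rest h ht) hdiv hB x y

/-- **The physical gauge pins the rest state.** For a rest-state classical forced solution on the
open past (`u ≡ 0`, any viscosity) whose force is divergence free on every past slice and inside a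
scale-invariant envelope `HasDefectBound M d`, the force VANISHES on the open past: `d t = 0` for
every `t < 0`.  (So the v3 witness class `u ≡ 0, d = ∇q ≠ 0` of `DefectGauge.lean` is empty in the
v4 gauge `InPhysicalGauge M d`.) [cite: KochNadirashviliSereginSverak2009, Lemma 3.1] -/
theorem defect_eq_zero_of_rest_physical (h : IsClassicalNSSolutionOn (Iio 0) ν d 0 p)
    (hdiv : ∀ t < 0, VectorCalculus.IsDivFree (d t)) (hM : HasDefectBound M d) :
    ∀ t < 0, d t = 0 := by
  intro t ht
  have hconst := defect_slice_const_of_rest h (mem_Iio.mpr ht) (hdiv t ht)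
    (HasDefectBound.norm_le_unif hM ht)
  exact eq_zero_of_const_of_envelope hconst (hM t ht)

/-! ## §4 Consequences for the v4 letter of the K2 plan -/

/-- The zero slice is divergence free. [folklore] -/
theorem isDivFree_zero_slice :
    VectorCalculus.IsDivFree (0 : EuclideanSpace ℝ (Fin 3) → EuclideanSpace ℝ (Fin 3)) := by
  intro x
  show LinearMap.trace ℝ _ (fderiv ℝ (0 : EuclideanSpace ℝ (Fin 3) → EuclideanSpace ℝ (Fin 3)) x :
    EuclideanSpace ℝ (Fin 3) →ₗ[ℝ] EuclideanSpace ℝ (Fin 3)) = 0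
  simp

/-- A force vanishing on the open past obeys the scale-invariant bound with every `η ≥ 0`.
[folklore] -/
theorem hasDefectBound_of_eq_zero (hd : ∀ t < 0, d t = 0) {η : ℝ} (hη : 0 ≤ η) :
    HasDefectBound η d := by
  intro t ht x
  rw [hd t ht]
  show ‖(0 : EuclideanSpace ℝ (Fin 3))‖ ≤ η / (‖x‖ + Real.sqrt (-t)) ^ 3
  rw [norm_zero]
  positivity

/-- **v4 stub 2 (`stub_defect_decay_physical`) is TRUE on the whole rest-state class, with any
size `η ≥ 0`:** a rest-state classical forced solution on the open past in the physical gauge obeys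
`HasDefectBound η d` for every `η ≥ 0` — the rest-state witnesses that refute the v3 stub
(`NoOverheatingDefectGauge.stub_defect_decay_false`,
`NoOverheatingDefectGaugeDivFree.stub_defect_decay_false_of_divFree_gate`) have no analogue
against v4 (`η ≥ 0` is needed: `HasDefectBound η 0` is false for `η < 0`). [folklore] -/
theorem hasDefectBound_of_rest_physical (h : IsClassicalNSSolutionOn (Iio 0) ν d 0 p)
    (hdiv : ∀ t < 0, VectorCalculus.IsDivFree (d t)) (hM : HasDefectBound M d) {η : ℝ}
    (hη : 0 ≤ η) : HasDefectBound η d :=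
  hasDefectBound_of_eq_zero (defect_eq_zero_of_rest_physical h hdiv hM) hη

/-- Rung-profile packaging (any level `L`, any constants): a REST-STATE rung profile lies in the
physical gauge with envelope `M` iff its defect vanishes on the open past and `0 ≤ M`.  In words:
inside v4's gauge the rest state carries no defect at all, at every level of the ladder. [folklore] -/
theorem restProfile_physicalGauge_iff {L : ℕ} {C₀ c : ℝ}
    {R : EuclideanSpace ℝ (Fin 3) ≃ₗᵢ[ℝ] EuclideanSpace ℝ (Fin 3)}
    (h : IsRungProfile L C₀ c R 0 p d) :
    ((∀ t < 0, VectorCalculus.IsDivFree (d t)) ∧ HasDefectBound M d) ↔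
      (∀ t < 0, d t = 0) ∧ 0 ≤ M := by
  constructor
  · rintro ⟨hdiv, hM⟩
    exact ⟨defect_eq_zero_of_rest_physical h.classical hdiv hM, HasDefectBound.nonneg hM⟩
  · rintro ⟨hd, hM0⟩
    refine ⟨fun t ht => ?_, hasDefectBound_of_eq_zero hd hM0⟩
    rw [hd t ht]
    exact isDivFree_zero_slice

/-- Hence a physical-gauge inhabitant of v4 stub 2's hypotheses whose defect is NOT inside some
envelope `η ≥ 0` is NOT at rest: its velocity is non-zero somewhere on the open past — it is a
genuine (nontrivial) Type-I rotated-DSS ancient rung profile, the object K1 `RungBlowupCofinal`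
asks for. [folklore] -/
theorem velocity_ne_zero_of_physical_defect {L : ℕ} {C₀ c η : ℝ}
    {R : EuclideanSpace ℝ (Fin 3) ≃ₗᵢ[ℝ] EuclideanSpace ℝ (Fin 3)}
    (h : IsRungProfile L C₀ c R u p d) (hdiv : ∀ t < 0, VectorCalculus.IsDivFree (d t))
    (hM : HasDefectBound M d) (hη : 0 ≤ η) (hbad : ¬ HasDefectBound η d) : u ≠ 0 := by
  rintro rfl
  exact hbad (hasDefectBound_of_rest_physical h.classical hdiv hM hη)

/-! ## §5 The physical gauge is a gauge FIXING: uniqueness of the defect for a general velocity -/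

/-- `div (v − w) = div v − div w` at a point of differentiability. [folklore] -/
theorem divergence_sub_apply {v w : EuclideanSpace ℝ (Fin 3) → EuclideanSpace ℝ (Fin 3)}
    {x : EuclideanSpace ℝ (Fin 3)} (hv : DifferentiableAt ℝ v x) (hw : DifferentiableAt ℝ w x) :
    VectorCalculus.divergence (v - w) x =
      VectorCalculus.divergence v x - VectorCalculus.divergence w x := by
  unfold VectorCalculus.divergence
  rw [fderiv_sub hv hw]
  simp

/-- Two forcing/pressure pairs `(p, d)`, `(p', d')` driving the SAME classical solution `u` differ
by a gradient on every slice: `d − d' = ∇(p − p')`. [folklore] -/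
theorem defect_sub_eq_gradient (h : IsClassicalNSSolutionOn S ν d u p)
    (h' : IsClassicalNSSolutionOn S ν d' u p') {t : ℝ} (ht : t ∈ S)
    (x : EuclideanSpace ℝ (Fin 3)) :
    d t x - d' t x = gradient (fun y => p t y - p' t y) x := by
  have hm := h.momentum t ht x
  have hm' := h'.momentum t ht x
  have hp : DifferentiableAt ℝ (p t) x :=
    ((h.contDiff_pressure ht).differentiable (by simp)) x
  have hp' : DifferentiableAt ℝ (p' t) x :=
    ((h'.contDiff_pressure ht).differentiable (by simp)) x
  have hg : gradient (fun y => p t y - p' t y) x = gradient (p t) x - gradient (p' t) x := by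
    have e1 : (fun y => p t y - p' t y) = p t - p' t := rfl
    rw [e1]
    unfold gradient
    rw [fderiv_sub hp hp', map_sub]
  rw [hg]
  have key : ν • Δ (u t) x - gradient (p t) x + d t x = ν • Δ (u t) x - gradient (p' t) x + d' t x := by
    rw [← hm, ← hm']
  have k2 : d t x - d' t x - (gradient (p t) x - gradient (p' t) x) = 0 := by
    have := sub_eq_zero.mpr key
    -- (νΔu − ∇p + d) − (νΔu − ∇p' + d') = d − d' − (∇p − ∇p')
    have e : ν • Δ (u t) x - gradient (p t) x + d t x - (ν • Δ (u t) x - gradient (p' t) x + d' t x)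
        = d t x - d' t x - (gradient (p t) x - gradient (p' t) x) := by abel
    rw [e] at this
    exact this
  exact sub_eq_zero.mp k2

/-- **Uniqueness of the physical-gauge defect.** If `(p, d)` and `(p', d')` both drive the same
classical solution `u` on the open past, both forces are divergence free on every past slice and
both lie in scale-invariant envelopes, then `d = d'` on the open past: the difference is the
smooth (the equation determines the force, tree `isSmoothSpaceTimeOn_force`) curl-free,
divergence-free, bounded field `∇(p − p')(t,·)`, constant by Liouville and `0` by the envelopes.
So v4's `InPhysicalGauge` is a genuine gauge FIXING: the defect of a physical-gauge rung profile is
a functional of its velocity alone. [cite: KochNadirashviliSereginSverak2009, Lemma 3.1] -/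
theorem physicalGauge_defect_unique {M' : ℝ} (h : IsClassicalNSSolutionOn (Iio 0) ν d u p)
    (h' : IsClassicalNSSolutionOn (Iio 0) ν d' u p')
    (hdiv : ∀ t < 0, VectorCalculus.IsDivFree (d t)) (hM : HasDefectBound M d)
    (hdiv' : ∀ t < 0, VectorCalculus.IsDivFree (d' t)) (hM' : HasDefectBound M' d') :
    ∀ t < 0, d t = d' t := by
  intro t ht
  have htS : t ∈ Iio (0 : ℝ) := mem_Iio.mpr ht
  have hU : UniqueDiffOn ℝ (Iio (0 : ℝ)) := isOpen_Iio.uniqueDiffOn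
  have hsd : ContDiff ℝ ∞ (d t) := (h.isSmoothSpaceTimeOn_force hU).contDiff_slice htS
  have hsd' : ContDiff ℝ ∞ (d' t) := (h'.isSmoothSpaceTimeOn_force hU).contDiff_slice htS
  have hqs : ContDiff ℝ ∞ (fun y => p t y - p' t y) :=
    (h.contDiff_pressure htS).sub (h'.contDiff_pressure htS)
  have hV : d t - d' t = gradient (fun y => p t y - p' t y) :=
    funext fun x => defect_sub_eq_gradient h h' htS x
  have hV2 : ContDiff ℝ 2 (d t - d' t) := (hsd.sub hsd').of_le (by norm_cast)
  have hcurl : ∀ x, curl (d t - d' t) x = 0 := fun x => by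
    rw [hV]
    exact curl_gradient_eq_zero_holds _ (hqs.of_le (by norm_cast)) x
  have hdivV : VectorCalculus.IsDivFree (d t - d' t) := fun x => by
    rw [divergence_sub_apply ((hsd.differentiable (by simp)) x) ((hsd'.differentiable (by simp)) x),
      hdiv t ht x, hdiv' t ht x, sub_zero]
  have hB : ∀ x, ‖(d t - d' t) x‖ ≤ M / Real.sqrt (-t) ^ 3 + M' / Real.sqrt (-t) ^ 3 := fun x => by
    rw [Pi.sub_apply]
    exact (norm_sub_le _ _).trans
      (add_le_add (HasDefectBound.norm_le_unif hM ht x) (HasDefectBound.norm_le_unif hM' ht x))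
  have hconst : ∀ x y, (d t - d' t) x = (d t - d' t) y :=
    eq_of_curl_eq_zero_of_isDivFree_of_bounded hV2 hcurl hdivV hB
  have henv : ∀ x, ‖(d t - d' t) x‖ ≤ (M + M') / (‖x‖ + Real.sqrt (-t)) ^ 3 := fun x => by
    rw [Pi.sub_apply, add_div]
    exact (norm_sub_le _ _).trans (add_le_add (hM t ht x) (hM' t ht x))
  exact sub_eq_zero.mp (eq_zero_of_const_of_envelope hconst henv)

/-- Rung-profile form of §5 (any level, any constants): two physical-gauge rung profiles with the
same velocity have the same defect on the open past. [cite: KochNadirashviliSereginSverak2009, Lemma 3.1] -/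
theorem IsRungProfile.physicalGauge_defect_unique {L L' : ℕ} {C₀ C₀' c c' M' : ℝ}
    {R R' : EuclideanSpace ℝ (Fin 3) ≃ₗᵢ[ℝ] EuclideanSpace ℝ (Fin 3)}
    (h : IsRungProfile L C₀ c R u p d) (h' : IsRungProfile L' C₀' c' R' u p' d')
    (hdiv : ∀ t < 0, VectorCalculus.IsDivFree (d t)) (hM : HasDefectBound M d)
    (hdiv' : ∀ t < 0, VectorCalculus.IsDivFree (d' t)) (hM' : HasDefectBound M' d') :
    ∀ t < 0, d t = d' t :=
  Summit.NavierStokesRegularity.NoOverheatingPhysicalGaugeRestState.physicalGauge_defect_unique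
    h.classical h'.classical hdiv hM hdiv' hM'

end Summit.NavierStokesRegularity.NoOverheatingPhysicalGaugeRestState

end
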